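import Mathlib
import Literature.Computability.AlgebraicComplexity.OrbitCoordinateRingProofs
import Summits.ValiantsHypothesis.ValiantsHypothesis.Theses.ValuativeGCT

/-!
# `ValuativeGCT.OrbitMapKernel` (stmt-ValiantsHypothesis-12627) — kernel of the End-orbit pull-back

The route's support statement `OrbitMapKernel`: a polynomial `F` in the degree-`m` coefficients
vanishes on the `GL_{m²}`-orbit of `det_m` (i.e. lies in
`orbitVanishingIdeal (detFormLex ℂ m) m`) iff `F(coefficients of det_m(x · A))` is the zero
polynomial in the entries of the generic `m² × m²` matrix `A`.

Proof: the right-hand side is `F ∈ ker (genericOrbitMap (detFormLex ℂ m) m)` with the generic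
orbit map written out (`Matrix.of fun j i => X (j, i)` is Mathlib's `Matrix.mvPolynomialX`
definitionally), and over the infinite field `ℂ` the tree's
`Literature.Computability.AlgebraicComplexity.orbitVanishingIdeal_eq_ker_genericOrbitMap`
(`GL` is Zariski dense in `End`, Mathlib `MvPolynomial.eq_of_eval_eq_on_gl`) identifies the orbit
vanishing ideal with that kernel. Mulmuley–Sohoni 2001 §4. [folklore]
-/

namespace Summit.ValiantsHypothesis.ValiantsHypothesis.Theorems

open Literature.NumberTheory.DiophantineGeometry Literature.Computability.AlgebraicComplexity

-- `Summit.ValiantsHypothesis.ValiantsHypothesis.…` is the tree's mandated single-conjunct layout (Sub = Summit).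
set_option linter.dupNamespace false

/-- **`OrbitMapKernel` holds** (item stmt-ValiantsHypothesis-12627 of route ValuativeGCT): for every
`m` and every polynomial `F` on the degree-`m` coefficient space,
`F ∈ I(GL · det_m)` iff the generic End-orbit pull-back of `F` — `F` evaluated at the coefficient
vector of `det_m(x · A)` for the generic matrix `A = (X (j, i))` — is the zero polynomial.
Immediate from `orbitVanishingIdeal_eq_ker_genericOrbitMap` (Mulmuley–Sohoni 2001 §4; `GL_{m²}(ℂ)`
is Zariski dense in `End`). [folklore] -/
theorem orbitMapKernel_proof :
    Summit.ValiantsHypothesis.ValiantsHypothesis.Theses.ValuativeGCT.OrbitMapKernel := by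
  unfold Summit.ValiantsHypothesis.ValiantsHypothesis.Theses.ValuativeGCT.OrbitMapKernel
  intro m F
  rw [orbitVanishingIdeal_eq_ker_genericOrbitMap, RingHom.mem_ker]
  rfl

end Summit.ValiantsHypothesis.ValiantsHypothesis.Theorems
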